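import Literature.AlgebraicGeometry.HodgeTheory.AtiyahClassTraceReal
import Mathlib.CategoryTheory.Limits.Shapes.IsTerminal
import HarnessLib

/-!
# The real trace on `Ext` in degree `0` is the trace of an endomorphism

A consistency (non-vacuity) check on the construction of `HodgeTheory/AtiyahClassTraceReal.lean`:
for a finite locally free `𝒪_X`-module `E` on a scheme `X` and an endomorphism `φ : E → E`, the class
`Tr(φ) := traceToCohomology hE 0 [φ] ∈ H⁰(X, 𝒪_X)` corresponds, under Mathlib's identification
`Sheaf.H.equiv₀ : H⁰(X, F) ≃ F(X)` at the terminal open, to the global section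
`tr(φ|_X) ∈ Γ(X, 𝒪_X)` given by the sheaf-level trace `Modules.trace` of
`Modules/LocallyFreeTrace.lean` (locally `∑ᵢ λᵢ(φ(bᵢ))`, `Modules.trace_app_eq_sum`). In words: in
degree `0` the `Ext`-level trace of Illusie / Buchweitz–Flenner ([BuchweitzFlenner2003] §4,
"`Tr : Ext^k_X(F, F ⊗ G) → H^k(X, G)`, `k ≥ 0`") IS the ordinary trace of an endomorphism of a
vector bundle.

* `extToCohomology_mk₀_equiv₀` — `Ext⁰(𝒪_X, G) → H⁰(X, G)` sends `f : 𝒪_X → G` to `f(1)`;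
* `traceExt_mk₀` — on `Ext⁰`, `Tr[φ] = [𝒪_X → 𝓔nd(E) → 𝓔nd(E) → 𝒪_X]` (`a ↦ tr(a φ)`);
* `equiv₀_traceToCohomology_mk₀` — the statement above.

## References

* [BuchweitzFlenner2003] R.-O. Buchweitz, H. Flenner, Compositio Math. 137 (2003), §4 (trace map).
* [Hartshorne1977] R. Hartshorne, *Algebraic Geometry* (1977), III Prop. 6.3 (c)
  (`Ext⁰(𝒪_X, G) = Γ(X, G)`), II Ex. 5.1.
-/

noncomputable section

open CategoryTheory CategoryTheory.Abelian AlgebraicGeometry Opposite TopologicalSpace Limits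

namespace Literature.AlgebraicGeometry.HodgeTheory

open Literature.AlgebraicGeometry.Modules Literature.AlgebraicGeometry.Motives

universe w u

variable {X : Scheme.{u}}

/-- `1 ∈ H⁰(X, 𝒪_X)` corresponds to the unit section. [folklore] -/
@[simp]
lemma equiv₀_oneClass :
    Sheaf.H.equiv₀ ((modulesToSheaf X).obj (unitModule X)) isTerminalTop (oneClass X) =
      (1 : X.presheaf.obj (op ⊤)) :=
  AddEquiv.apply_symm_apply _ _

variable [HasExt.{w} X.Modules]

/-- **In degree `0`, `Ext⁰(𝒪_X, G) → H⁰(X, G) = Γ(X, G)` is `f ↦ f(1)`.**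
[cite: Hartshorne1977, III Prop. 6.3 (c)] -/
theorem extToCohomology_mk₀_equiv₀ (G : X.Modules) (f : unitModule X ⟶ G) :
    Sheaf.H.equiv₀ ((modulesToSheaf X).obj G) isTerminalTop
      (extToCohomology G 0 (Ext.mk₀.{w} f)) = f.app ⊤ (1 : X.presheaf.obj (op ⊤)) := by
  have h1 : extToCohomology G 0 (Ext.mk₀.{w} f) =
      Sheaf.H.map ((modulesToSheaf X).map f) 0 (oneClass X) := by
    rw [extToCohomology_apply, Sheaf.H.map_apply]
    exact congrArg (fun y => (oneClass X).comp y (zero_add 0)) (Ext.mapExactFunctor_mk₀ _ f)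
  rw [h1]
  refine (Sheaf.H.equiv₀_naturality (hT := isTerminalTop) ((modulesToSheaf X).map f)
    (oneClass X)).symm.trans ?_
  rw [equiv₀_oneClass]
  rfl

variable {E : X.Modules} (hE : IsFiniteLocallyFree E)

/-- **On `Ext⁰` the trace is composition with the sheaf trace**: for `φ : E → E`,
`Tr[φ] = [𝒪_X → 𝓔nd(E) → 𝓔nd(E) → 𝒪_X]`, `a ↦ a · id ↦ a φ ↦ tr(a φ)`.
[cite: BuchweitzFlenner2003, §4 (trace map)] -/
theorem traceExt_mk₀ (φ : E ⟶ E) :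
    traceExt hE 0 (Ext.mk₀.{w} φ) = Ext.mk₀ (sheafHomUnit E ≫ sheafHomMap E φ ≫ trace hE) := by
  haveI := preservesFiniteColimits_sheafHomFunctor E hE
  have h1 : (Ext.mk₀.{w} φ).mapExactFunctor (sheafHomFunctor E) =
      Ext.mk₀ ((sheafHomFunctor E).map φ) :=
    Ext.mapExactFunctor_mk₀ _ φ
  rw [traceExt_apply, h1]
  change (Ext.mk₀ (sheafHomUnit E)).comp ((Ext.mk₀ (sheafHomMap E φ)).comp
    (Ext.mk₀ (trace hE)) (add_zero 0)) (zero_add 0) = _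
  rw [Ext.mk₀_comp_mk₀, Ext.mk₀_comp_mk₀]

/-- **In degree `0` the `Ext`-level trace IS the trace of an endomorphism**: for `φ : E → E`,
`Tr[φ] ∈ H⁰(X, 𝒪_X)` corresponds under `H⁰(X, 𝒪_X) ≃ Γ(X, 𝒪_X)` to the global section
`tr(φ|_X)` of the sheaf-level trace (`= ∑ᵢ λᵢ(φ(bᵢ))` in any local frame,
`Modules.trace_app_eq_sum`). [cite: BuchweitzFlenner2003, §4 (trace map)] -/
theorem equiv₀_traceToCohomology_mk₀ (φ : E ⟶ E) :
    Sheaf.H.equiv₀ ((modulesToSheaf X).obj (unitModule X)) isTerminalTop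
        (traceToCohomology hE 0 (Ext.mk₀.{w} φ)) =
      ((trace hE).app ⊤ ((SheafOfModules.overFunctor _ ⊤).map φ) : X.presheaf.obj (op ⊤)) := by
  change Sheaf.H.equiv₀ ((modulesToSheaf X).obj (unitModule X)) isTerminalTop
    (extToCohomology (unitModule X) 0 (traceExt hE 0 (Ext.mk₀.{w} φ))) = _
  rw [traceExt_mk₀, extToCohomology_mk₀_equiv₀]
  change (trace hE).app ⊤ ((sheafHomMap E φ).app ⊤ ((sheafHomUnit E).app ⊤
    (1 : X.presheaf.obj (op ⊤)))) = _
  rw [sheafHomUnit_app_apply, overScalar_one, sheafHomMap_app_apply, Category.id_comp]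

end Literature.AlgebraicGeometry.HodgeTheory

end
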